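import Summits.QuantumFields.YangMills.Theorems.BalabanUVNodesN17AtRecord12

/-!
# BalabanUVNodes ∕ node N17 = NE4 AT THE STAGE-12 DATUM IN def-B's β VOCABULARY (`betaOfRecord₁₁ ∕ betaMergedOfRecord₁₁ ∕ beta0OfRecord₁₁ ∕
# oneLoopSplitOfRecord₁₁` READ AT THE STAGE-11 VIEW `θ.toStage11 F N p`, any run `p`, `rfl`), THE SPLIT ROAD AT THE PRINTED SPLIT OF RECORD, and
# WHAT N17 DELIVERS TO K2′ AT STAGE 12: (AF-0r) for the one-loop numbers of record ⟹ `EndpointExistence (datumOfRecord₁₂ θ h).C.toB12`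

Cell `pub-ymgap`, HUMAN RULING D-0062, seat `pub-ymgap-dag-n17-c` (R134 fan-out, s2), generation 3; companion 14 (§46–§48) of `BalabanUVNodesN17Knit` … `…N17AtRecord12`
(companion 13).  THEOREMS ONLY; imports companion 13 (hence companion 10 `…N17AtRecord11Beta`, def-B's `Node00/Record11Beta` — `betaMergedOfRecord₁₁`,
`beta0OfRecord₁₁`, `betaOfRecord₁₁` (reducible), `oneLoopSplitOfRecord₁₁`, `betaContH_betaOfRecord₁₁_iff` … — and def-T's `Node00/Record12`); modifies nothing;
every cited lemma used BY NAME.  Stage-12 twin of companion 10 (p457220, §34–§36), which is VACUOUS at Stage 11 (`Node00.not_provisos₁₁`).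

THE POINT.  def-B's β-side names are keyed on `Stage11Params` but READ ONLY ITS STAGE-9 PART (`θ.toStage9Params`, `θ.ν`, `θ.εbg`, `θ.ρ8`, `θ.bV`, `θ.v₀`, `θ.γ`);
def-T's Stage-11 VIEW `θ.toStage11 F N p` of a `θ : Stage12Params F N` (Record12 §2; it re-binds only the weight binder `Wt` to the 𝐓-weights of record of the runs
`⟨K, p.m, p.g0⟩`) has the SAME Stage-9 part (`Stage12Params.toStage11_toStage9Params`, `rfl`).  Hence, for EVERY run `p`,
`(datumOfRecord₁₂ F N θ h).βfun = betaOfRecord₁₀ F N θ.toStage9Params = betaOfRecord₁₁ F N (θ.toStage11 F N p)` (`rfl`; dag-n26-c's `…_eq_betaOfRecord₁₁_view`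
convention, not re-declared here), `betaMergedOfRecord₁₁ F N (θ.toStage11 F N p)` IS companion 13's assembly line `βmT`, and `oneLoopSplitOfRecord₁₁ F N (θ.toStage11 F N p)`
IS the printed one-loop split OF THE STAGE-12 DATUM's β — the `OneLoopSplit` object K2′'s engine `Beta.AssemblyRemainder.endpointExistence_of_limit_remainderConst`
consumes.  (Should def-B mint `Record12Beta` names, every face below re-keys by `rfl` once more.)
* §46 N17 AT THE β OF RECORD BY NAME, Stage 12: `N17_datumOfRecord₁₂_iff_betaOfRecord₁₁_view` (ANY box side, `Iff.rfl`), `N17_datumOfRecord₁₂_iff_betaMergedOfRecord₁₁_view`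
  (`γ' ≤ θ.γ`), `n17At_datumOfRecord₁₂_iff_betaMergedOfRecord₁₁_view` ∕ `…_iff_betaOfRecord₁₁_view` (cluster K4's letters), `u2Inputs_datumOfRecord₁₂_iff_betaMergedOfRecord₁₁_view`.
* §47 THE SPLIT ROAD AT THE PRINTED SPLIT OF RECORD: `N17_datumOfRecord₁₂_of_split_view` ((AF-0r) for `beta0OfRecord₁₁ (θ.toStage11 p)` ∧
  `RemainderShiftRate (oneLoopSplitOfRecord₁₁ (θ.toStage11 p)) c₁ ρ γ'` ⟹ `NE4OnData (datumOfRecord₁₂ θ h) (2c₀ + c₁) ρ γ'`, every box side),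
  `remainderShiftRate_split_view_of_N17₁₂` (converse), `N17_of_isRecordOfRecord₁₂C_split` (over ₁₂C).
* §48 WHAT N17 DELIVERS TO K2′ AT THE RECORD: `cauchy_beta0OfRecord₁₁_view_of_N17₁₂`, `af0r_beta0OfRecord₁₁_view_of_N17₁₂`, `tendsto_beta0OfRecord₁₁_view_of_N17₁₂`
  (the one-loop numbers of record CONVERGE at a geometric rate), **`endpointExistence_datumOfRecord₁₂_of_N17`** (END at the Stage-12 datum from N17 + the SIGN of
  the one-loop limit + the constant-form remainder + the β box leaves — K2′'s conclusion `EndpointExistence D.C.toB12` at this datum, forward generation being the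
  datum's own field `fwd`), `af0r_beta0OfRecord₁₁_view_of_N17_isRecordOfRecord₁₂C` (∀-form over ₁₂C).
NOT VACUOUS at Stage 12 modulo K0′ `Record12Inhabited` (NOT claimed here).

HONEST FRAMING.  Kernel bookkeeping BY NAME; 0 sorry; NE4 NOT IN PRINT ([Balaban1987RG1] (1.20)–(1.22) p. 264) and NOT PROVED; (AF-0r) ∕ the remainder rate ∕
`Beta0LimitExists` ∕ (AF-0∞) ∕ `RemainderConst` ∕ the β box bounds ∕ B4 are displayed HYPOTHESES (N15 ∕ N16 ∕ N18 ∕ NODE O ∕ N26 rows); nothing of Bałaban's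
asserted; N17 = composite, NOT discharged; «A: n∕28» unmoved.  One finite four-torus at fixed ε per run — NOT infinite volume, NOT OS on ℝ⁴, NOT a mass gap, NOT Clay.
-/

noncomputable section

open scoped Matrix.Norms.L2Operator

namespace Summit.QuantumFields.YangMills.Theorems.BalabanUVNodesN17

open Filter Topology
open Literature.MathematicalPhysics.QuantumFieldTheory.Balaban1983to89
open Literature.MathematicalPhysics.QuantumFieldTheory.Balaban1983to89.FlowStep
open Literature.MathematicalPhysics.QuantumFieldTheory.Balaban1983to89.T4CouplingMatching
open Literature.MathematicalPhysics.QuantumFieldTheory.Balaban1983to89.T4Continuum (T4Family FiniteEpsData ULoop)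
open Literature.MathematicalPhysics.QuantumFieldTheory.Balaban1983to89.Beta.RemainderChain (RemainderConst)
open Literature.MathematicalPhysics.QuantumFieldTheory.Balaban1983to89.Beta.AssemblyRemainder (endpointExistence_of_limit_remainderConst)
open Literature.MathematicalPhysics.QuantumFieldTheory.Balaban1983to89.T4BetaMemorySharp (remainderShiftRate_of_scaleShiftRate)
open Literature.MathematicalPhysics.QuantumFieldTheory.Balaban1983to89.Node00
open Literature.MathematicalPhysics.QuantumFieldTheory.Balaban1983to89.DagBinding (WorldP EndpointExistence)
open Summit.QuantumFields.BalabanUV.T4Continuum.Spine.NE4 (NE4OnData U2Inputs ne4OnData_iff)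
open YMDAG.UVSplit (Datum U3Carriers N17At)

variable {F : T4Family} {N : ℕ} [NeZero N]

/-! ## §46 N17 AT THE STAGE-12 DATUM IN def-B's NAMES, READ AT THE STAGE-11 VIEW `θ.toStage11 F N p` (any run `p`) -/

/-- **N17 AT THE STAGE-12 DATUM IS THE SCALE-SHIFT RATE OF THE β OF RECORD `betaOfRecord₁₁ (θ.toStage11 F N p)`** — ANY run `p`, EVERY box side `γ'`
(`(datumOfRecord₁₂ θ h).βfun = betaOfRecord₁₀ θ.toStage9Params = betaOfRecord₁₁ (θ.toStage11 F N p)`, `rfl`; `Iff.rfl`). [cite: Balaban1987RG1, (1.20)-(1.22) p.264] -/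
theorem N17_datumOfRecord₁₂_iff_betaOfRecord₁₁_view (θ : Stage12Params F N) (h : θ.Provisos₁₂ F N) (p : B12.RunParams) (c ρ γ' : ℝ) :
    NE4OnData (datumOfRecord₁₂ F N θ h) c ρ γ' ↔ ScaleShiftRate c ρ γ' (betaOfRecord₁₁ F N (θ.toStage11 F N p)) := Iff.rfl

/-- **… AND, ON BOXES INSIDE THE RECORD BOX (`γ' ≤ θ.γ`), OF THE MERGED β OF RECORD `betaMergedOfRecord₁₁ (θ.toStage11 F N p)`** = companion 13's assembly
line `βmT` (reducible). [cite: Balaban1987RG1, (1.22) p.264 and (2.12)-(2.14) p.268] -/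
theorem N17_datumOfRecord₁₂_iff_betaMergedOfRecord₁₁_view (θ : Stage12Params F N) (h : θ.Provisos₁₂ F N) (p : B12.RunParams) {c ρ γ' : ℝ}
    (hγ : γ' ≤ θ.γ) :
    NE4OnData (datumOfRecord₁₂ F N θ h) c ρ γ' ↔ ScaleShiftRate c ρ γ' (betaMergedOfRecord₁₁ F N (θ.toStage11 F N p)) :=
  N17_datumOfRecord₁₂_iff_merged θ h hγ

/-- **… IN CLUSTER K4's LETTERS**: for node U3's carriers `u` with `u.γ ≤ θ.γ`,
`N17At (datumOfRecord₁₂ θ h) u ↔ ScaleShiftRate (u.cr·u.C₅·u.θ) u.ρ u.γ (betaMergedOfRecord₁₁ (θ.toStage11 F N p))`. [cite: Balaban1987RG1, (1.20)-(1.22) p.264] -/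
theorem n17At_datumOfRecord₁₂_iff_betaMergedOfRecord₁₁_view (θ : Stage12Params F N) (h : θ.Provisos₁₂ F N) (p : B12.RunParams) (u : U3Carriers)
    (hγ : u.γ ≤ θ.γ) :
    N17At (datumOfRecord₁₂ F N θ h) u ↔ ScaleShiftRate (u.cr * u.C₅ * u.θ) u.ρ u.γ (betaMergedOfRecord₁₁ F N (θ.toStage11 F N p)) :=
  n17At_datumOfRecord₁₂_iff_merged θ h u hγ

/-- **K4's letters, ANY box side**: `N17At (datumOfRecord₁₂ θ h) u ↔ ScaleShiftRate (u.cr·u.C₅·u.θ) u.ρ u.γ (betaOfRecord₁₁ (θ.toStage11 F N p))` (`Iff.rfl`).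
[cite: Balaban1987RG1, (1.20)-(1.22) p.264] -/
theorem n17At_datumOfRecord₁₂_iff_betaOfRecord₁₁_view (θ : Stage12Params F N) (h : θ.Provisos₁₂ F N) (p : B12.RunParams) (u : U3Carriers) :
    N17At (datumOfRecord₁₂ F N θ h) u ↔ ScaleShiftRate (u.cr * u.C₅ * u.θ) u.ρ u.γ (betaOfRecord₁₁ F N (θ.toStage11 F N p)) := Iff.rfl

/-- **NODE U2's INPUT TRIPLE AT THE STAGE-12 DATUM, BY NAME** (box `γ' ≤ θ.γ`): the `betaMergedOfRecord₁₁ (θ.toStage11 F N p)` rate ∧ its history moduli ∧ the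
β-free fading-memory clause. [cite: Balaban1987RG1, §5 p.298] -/
theorem u2Inputs_datumOfRecord₁₂_iff_betaMergedOfRecord₁₁_view (θ : Stage12Params F N) (h : θ.Provisos₁₂ F N) (p : B12.RunParams) {c C ρ γ' : ℝ}
    {Λ : ℕ → ℕ → ℝ} (hγ : γ' ≤ θ.γ) :
    U2Inputs (datumOfRecord₁₂ F N θ h) c C ρ γ' Λ ↔
      ScaleShiftRate c ρ γ' (betaMergedOfRecord₁₁ F N (θ.toStage11 F N p)) ∧
        HistLipschitz Λ γ' (betaMergedOfRecord₁₁ F N (θ.toStage11 F N p)) ∧ FadingMemory C ρ Λ :=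
  u2Inputs_datumOfRecord₁₂_iff θ h hγ

/-! ## §47 THE SPLIT ROAD AT THE PRINTED SPLIT OF RECORD `oneLoopSplitOfRecord₁₁ (θ.toStage11 F N p)` — a `OneLoopSplit` OF THE STAGE-12 DATUM's β -/

/-- **THE SPLIT ROAD AT THE STAGE-12 DATUM, LITERALLY THROUGH THE PRINTED SPLIT OF RECORD**: (AF-0r) `|β⁰_{k+1} − β⁰_∞| ≤ c₀ρ^k` for the one-loop numbers of
record `beta0OfRecord₁₁ (θ.toStage11 p)` (N15 = NE2 ∕ NODE O currency, GAPS G-an2-4) ∧ `RemainderShiftRate (oneLoopSplitOfRecord₁₁ (θ.toStage11 p)) c₁ ρ γ'` (N16 =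
NE3 ∕ N18 = NE5), `0 ≤ ρ ≤ 1`, `0 ≤ c₀` ⟹ `NE4OnData (datumOfRecord₁₂ θ h) (2c₀ + c₁) ρ γ'` for EVERY box side `γ'` (`T4CouplingMatching.scaleShiftRate_of_split`).
Both binders UNPRINTED, displayed. [cite: Balaban1987RG1, (2.12)-(2.14) p.268] -/
theorem N17_datumOfRecord₁₂_of_split_view (θ : Stage12Params F N) (h : θ.Provisos₁₂ F N) (p : B12.RunParams) {binf c₀ c₁ ρ γ' : ℝ} (hρ0 : 0 ≤ ρ)
    (hρ1 : ρ ≤ 1) (hc₀ : 0 ≤ c₀) (hconv : ∀ k, |beta0OfRecord₁₁ F N (θ.toStage11 F N p) k - binf| ≤ c₀ * ρ ^ k)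
    (hrem : RemainderShiftRate (oneLoopSplitOfRecord₁₁ F N (θ.toStage11 F N p)) c₁ ρ γ') :
    NE4OnData (datumOfRecord₁₂ F N θ h) (2 * c₀ + c₁) ρ γ' :=
  scaleShiftRate_of_split (oneLoopSplitOfRecord₁₁ F N (θ.toStage11 F N p)) hρ0 hρ1 hc₀ hconv hrem

/-- **CONVERSELY: N17 AT THE STAGE-12 DATUM ∧ (AF-0r) FOR THE ONE-LOOP NUMBERS OF RECORD ⟹ THE REMAINDER's SCALE-SHIFT RATE AT THE SPLIT OF RECORD**,
constant `c + 2c₀`, every box side (`T4BetaMemorySharp.remainderShiftRate_of_scaleShiftRate`). [folklore] -/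
theorem remainderShiftRate_split_view_of_N17₁₂ (θ : Stage12Params F N) (h : θ.Provisos₁₂ F N) (p : B12.RunParams) {binf c₀ c ρ γ' : ℝ} (hρ0 : 0 ≤ ρ)
    (hρ1 : ρ ≤ 1) (hc₀ : 0 ≤ c₀) (hconv : ∀ k, |beta0OfRecord₁₁ F N (θ.toStage11 F N p) k - binf| ≤ c₀ * ρ ^ k)
    (hN17 : NE4OnData (datumOfRecord₁₂ F N θ h) c ρ γ') :
    RemainderShiftRate (oneLoopSplitOfRecord₁₁ F N (θ.toStage11 F N p)) (c + 2 * c₀) ρ γ' :=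
  remainderShiftRate_of_scaleShiftRate (oneLoopSplitOfRecord₁₁ F N (θ.toStage11 F N p)) hρ0 hρ1 hc₀ hconv hN17

/-- **THE SPLIT ROAD OVER THE STAGE-12 RECORD, BY NAME**: if every presentation `(θ, hP)` of `(D, w)` with `w.γ ≤ θ.γ` carries, at some run `p` (the β-side names do
not depend on it), (AF-0r) for `beta0OfRecord₁₁ (θ.toStage11 p)` (constant `c₀ ≥ 0`) and `RemainderShiftRate (oneLoopSplitOfRecord₁₁ (θ.toStage11 p)) c₁ ρ w.γ`,
`0 ≤ ρ ≤ 1`, then `NE4OnData D (2c₀ + c₁) ρ w.γ`. [cite: Balaban1987RG1, (2.12)-(2.14) p.268; Balaban1989LargeFieldII, Thm 1 p.355] -/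
theorem N17_of_isRecordOfRecord₁₂C_split {D : Datum F N} {w : WorldP} (h : IsRecordOfRecord₁₂C F N D w) {c₀ c₁ ρ : ℝ} (hρ0 : 0 ≤ ρ)
    (hρ1 : ρ ≤ 1) (hc₀ : 0 ≤ c₀)
    (hin : ∀ (θ : Stage12Params F N) (hP : θ.Provisos₁₂ F N), θ.Admissible F N → D = datumOfRecord₁₂ F N θ hP → w.γ ≤ θ.γ →
      ∃ (p : B12.RunParams) (binf : ℝ), (∀ k, |beta0OfRecord₁₁ F N (θ.toStage11 F N p) k - binf| ≤ c₀ * ρ ^ k) ∧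
        RemainderShiftRate (oneLoopSplitOfRecord₁₁ F N (θ.toStage11 F N p)) c₁ ρ w.γ) :
    NE4OnData D (2 * c₀ + c₁) ρ w.γ := by
  obtain ⟨θ, hP, hθ, hD, -, ⟨-, hγle⟩, -, -⟩ := h
  obtain ⟨p, binf, hconv, hrem⟩ := hin θ hP hθ hD hγle
  subst hD
  exact N17_datumOfRecord₁₂_of_split_view θ hP p hρ0 hρ1 hc₀ hconv hrem

/-! ## §48 WHAT N17 DELIVERS TO THE β ∕ ENDPOINT SIDE (K2′) AT THE STAGE-12 RECORD: (AF-0r) for `beta0OfRecord₁₁ (θ.toStage11 p)` ⟹ `EndpointExistence` -/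

/-- **N17 AT THE STAGE-12 DATUM ⟹ THE CAUCHY FORM OF (AF-0r) FOR THE ONE-LOOP NUMBERS OF RECORD**: on a box side `0 < γ' ≤ θ.γ`, if the definer's one-sided
limit `Beta0LimitExists (betaMergedOfRecord₁₁ (θ.toStage11 p)) θ.v₀` holds at COHERENT reference histories with entries in `]0,γ']`, then
`NE4OnData (datumOfRecord₁₂ θ h) c ρ γ'` gives `|β⁰_{k+2} − β⁰_{k+1}| ≤ cρ^k` for `β⁰ := beta0OfRecord₁₁ (θ.toStage11 p)` (companion 4 `abs_beta0OfMerged_step_le`).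
[cite: Balaban1987RG1, (2.12)-(2.14) p.268] -/
theorem cauchy_beta0OfRecord₁₁_view_of_N17₁₂ (θ : Stage12Params F N) (h : θ.Provisos₁₂ F N) (p : B12.RunParams) {c ρ γ' : ℝ} (hγ : γ' ≤ θ.γ)
    (hγ' : 0 < γ') (hlim : Beta0LimitExists (betaMergedOfRecord₁₁ F N (θ.toStage11 F N p)) θ.v₀)
    (hcoh : ∀ k, Fin.tail (θ.v₀ (k + 1)) = θ.v₀ k) (hadm : ∀ k i, 0 < θ.v₀ k i ∧ θ.v₀ k i ≤ γ')
    (hN17 : NE4OnData (datumOfRecord₁₂ F N θ h) c ρ γ') (k : ℕ) :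
    |beta0OfRecord₁₁ F N (θ.toStage11 F N p) (k + 1) - beta0OfRecord₁₁ F N (θ.toStage11 F N p) k| ≤ c * ρ ^ k :=
  abs_beta0OfMerged_step_le hlim hcoh hadm hγ' ((N17_datumOfRecord₁₂_iff_betaMergedOfRecord₁₁_view θ h p hγ).mp hN17) k

/-- **N17 AT THE STAGE-12 DATUM ⟹ (AF-0r) FOR THE ONE-LOOP NUMBERS OF RECORD**: with `ρ < 1` in addition,
`∃ β⁰_∞, ∀ k, |beta0OfRecord₁₁ (θ.toStage11 p) k − β⁰_∞| ≤ (c∕(1−ρ))ρ^k` — LITERALLY the `hconv` input of `Beta.AssemblyRemainder.endpointExistence_of_limit_remainderConst`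
at the split of record `oneLoopSplitOfRecord₁₁ (θ.toStage11 p)` (`oneLoopSplitOfRecord₁₁_β0`, `rfl`).  The node's β⁰-half is an OUTPUT at the record
(companion 4 `af0r_beta0OfMerged_of_scaleShiftRate`). [cite: Balaban1987RG1, (2.12)-(2.14) p.268] -/
theorem af0r_beta0OfRecord₁₁_view_of_N17₁₂ (θ : Stage12Params F N) (h : θ.Provisos₁₂ F N) (p : B12.RunParams) {c ρ γ' : ℝ} (hγ : γ' ≤ θ.γ)
    (hγ' : 0 < γ') (hρ1 : ρ < 1) (hlim : Beta0LimitExists (betaMergedOfRecord₁₁ F N (θ.toStage11 F N p)) θ.v₀)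
    (hcoh : ∀ k, Fin.tail (θ.v₀ (k + 1)) = θ.v₀ k) (hadm : ∀ k i, 0 < θ.v₀ k i ∧ θ.v₀ k i ≤ γ')
    (hN17 : NE4OnData (datumOfRecord₁₂ F N θ h) c ρ γ') :
    ∃ binf : ℝ, ∀ k, |beta0OfRecord₁₁ F N (θ.toStage11 F N p) k - binf| ≤ c / (1 - ρ) * ρ ^ k :=
  af0r_beta0OfMerged_of_scaleShiftRate hlim hcoh hadm hγ' hρ1 ((N17_datumOfRecord₁₂_iff_betaMergedOfRecord₁₁_view θ h p hγ).mp hN17)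

/-- **N17 AT THE STAGE-12 DATUM ⟹ THE ONE-LOOP NUMBERS OF RECORD CONVERGE, AT A GEOMETRIC RATE** (`0 ≤ ρ < 1`):
`∃ β⁰_∞, β⁰_k → β⁰_∞ ∧ |β⁰_k − β⁰_∞| ≤ (c∕(1−ρ))ρ^k` (companion 10 `tendsto_of_abs_sub_le_geometric`).  What remains for K2′ on the one-loop side is the SIGN of that
limit ((AF-0∞), NODE O's (2.14)), not its existence. [cite: Balaban1987RG1, (2.12)-(2.14) p.268] -/
theorem tendsto_beta0OfRecord₁₁_view_of_N17₁₂ (θ : Stage12Params F N) (h : θ.Provisos₁₂ F N) (p : B12.RunParams) {c ρ γ' : ℝ} (hγ : γ' ≤ θ.γ)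
    (hγ' : 0 < γ') (hρ0 : 0 ≤ ρ) (hρ1 : ρ < 1) (hlim : Beta0LimitExists (betaMergedOfRecord₁₁ F N (θ.toStage11 F N p)) θ.v₀)
    (hcoh : ∀ k, Fin.tail (θ.v₀ (k + 1)) = θ.v₀ k) (hadm : ∀ k i, 0 < θ.v₀ k i ∧ θ.v₀ k i ≤ γ')
    (hN17 : NE4OnData (datumOfRecord₁₂ F N θ h) c ρ γ') :
    ∃ binf : ℝ, Tendsto (beta0OfRecord₁₁ F N (θ.toStage11 F N p)) atTop (𝓝 binf) ∧
      ∀ k, |beta0OfRecord₁₁ F N (θ.toStage11 F N p) k - binf| ≤ c / (1 - ρ) * ρ ^ k := by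
  obtain ⟨binf, hconv⟩ := af0r_beta0OfRecord₁₁_view_of_N17₁₂ θ h p hγ hγ' hρ1 hlim hcoh hadm hN17
  exact ⟨binf, tendsto_of_abs_sub_le_geometric hρ0 hρ1 hconv, hconv⟩

/-- **THE N17 → K2′ EDGE AT THE STAGE-12 DATUM: ENDPOINT EXISTENCE FROM N17, THE SIGN OF THE ONE-LOOP LIMIT, THE CONSTANT-FORM REMAINDER AND THE β BOX LEAVES.**
N17 (`NE4OnData (datumOfRecord₁₂ θ h) c ρ γ'`, `0 < γ' ≤ θ.γ`, `0 ≤ ρ < 1`) with `Beta0LimitExists` at coherent admissible `θ.v₀` SUPPLIES (AF-0r) `hconv` for the split of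
record; the remaining leaves of K2′'s engine `Beta.AssemblyRemainder.endpointExistence_of_limit_remainderConst` are displayed: (AF-0∞) as a statement about THE
limit of the one-loop numbers of record (`0 < β⁰_∞` and the printed-type restriction `r ≤ β⁰_∞∕4` for every `b` with `β⁰_k → b` — NODE O's (2.14)), the
constant-form remainder `RemainderConst (oneLoopSplitOfRecord₁₁ (θ.toStage11 p)) γ₀ r` ([II] (2.41) → [I] (5.10)), and on `]0,γ₀]` the bounds `−β' ≤ β ≤ β'` and B4
`BetaContH γ₀` for `betaOfRecord₁₁ (θ.toStage11 p)`; forward generation is the Stage-12 datum's own field `fwd`.  CONCLUSION: `EndpointExistence (datumOfRecord₁₂ θ h).C.toB12`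
— K2′'s conclusion at this datum.  Nothing asserted; N17 is load-bearing (without convergence of `β⁰_k` the sign clause is idle).
[cite: Balaban1987RG1, Thm 2 p.259 (first sentence) and (2.12)-(2.14) p.268] -/
theorem endpointExistence_datumOfRecord₁₂_of_N17 (θ : Stage12Params F N) (h : θ.Provisos₁₂ F N) (p : B12.RunParams) {c ρ γ' γ₀ r β' : ℝ}
    (hγ : γ' ≤ θ.γ) (hγ' : 0 < γ') (hρ0 : 0 ≤ ρ) (hρ1 : ρ < 1)
    (hlim : Beta0LimitExists (betaMergedOfRecord₁₁ F N (θ.toStage11 F N p)) θ.v₀)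
    (hcoh : ∀ k, Fin.tail (θ.v₀ (k + 1)) = θ.v₀ k) (hadm : ∀ k i, 0 < θ.v₀ k i ∧ θ.v₀ k i ≤ γ')
    (hN17 : NE4OnData (datumOfRecord₁₂ F N θ h) c ρ γ')
    (hAF0 : ∀ b : ℝ, Tendsto (beta0OfRecord₁₁ F N (θ.toStage11 F N p)) atTop (𝓝 b) → 0 < b ∧ r ≤ b / 4)
    (hγ₀ : 0 < γ₀) (hrem : RemainderConst (oneLoopSplitOfRecord₁₁ F N (θ.toStage11 F N p)) γ₀ r)
    (hup : BetaUpperH β' γ₀ (betaOfRecord₁₁ F N (θ.toStage11 F N p)))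
    (hlo : ∀ k, ∀ v ∈ Box γ₀ k, -β' ≤ betaOfRecord₁₁ F N (θ.toStage11 F N p) k v)
    (hcont : BetaContH γ₀ (betaOfRecord₁₁ F N (θ.toStage11 F N p))) :
    EndpointExistence (datumOfRecord₁₂ F N θ h).C.toB12 := by
  obtain ⟨binf, htend, hconv⟩ := tendsto_beta0OfRecord₁₁_view_of_N17₁₂ θ h p hγ hγ' hρ0 hρ1 hlim hcoh hadm hN17
  obtain ⟨hbinf, hr⟩ := hAF0 binf htend
  have hc₀ : 0 ≤ c / (1 - ρ) := by
    have h0 := (abs_nonneg _).trans (hconv 0)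
    simpa using h0
  exact endpointExistence_of_limit_remainderConst (datumOfRecord₁₂ F N θ h).fwd (oneLoopSplitOfRecord₁₁ F N (θ.toStage11 F N p)) hγ₀ hbinf
    hc₀ hρ0 hρ1 hconv hrem hr hup hlo hcont

/-- **WHAT N17 DELIVERS AT A STAGE-12 RECORD, BY NAME**: `NE4OnData D c ρ w.γ` with `0 ≤ ρ < 1`, and — asked of every presentation `(θ, hP)` of `(D, w)` with
`w.γ ≤ θ.γ`, at a run `p` — `Beta0LimitExists (betaMergedOfRecord₁₁ (θ.toStage11 p)) θ.v₀` at coherent reference histories with entries in `]0, w.γ]` ⟹ SOME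
presentation and run with (AF-0r) `∃ β⁰_∞, |beta0OfRecord₁₁ (θ.toStage11 p) k − β⁰_∞| ≤ (c∕(1−ρ))ρ^k` AND convergence `beta0OfRecord₁₁ (θ.toStage11 p) → β⁰_∞`
(`0 < w.γ` is the record's clause). [cite: Balaban1987RG1, (2.12)-(2.14) p.268; Balaban1989LargeFieldII, Thm 1 p.355] -/
theorem af0r_beta0OfRecord₁₁_view_of_N17_isRecordOfRecord₁₂C {D : Datum F N} {w : WorldP} (h : IsRecordOfRecord₁₂C F N D w) {c ρ : ℝ}
    (hρ0 : 0 ≤ ρ) (hρ1 : ρ < 1) (hN17 : NE4OnData D c ρ w.γ)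
    (hin : ∀ (θ : Stage12Params F N) (hP : θ.Provisos₁₂ F N) (p : B12.RunParams), θ.Admissible F N → D = datumOfRecord₁₂ F N θ hP → w.γ ≤ θ.γ →
      Beta0LimitExists (betaMergedOfRecord₁₁ F N (θ.toStage11 F N p)) θ.v₀ ∧ (∀ k, Fin.tail (θ.v₀ (k + 1)) = θ.v₀ k) ∧
        ∀ k i, 0 < θ.v₀ k i ∧ θ.v₀ k i ≤ w.γ) (p : B12.RunParams) :
    ∃ (θ : Stage12Params F N) (hP : θ.Provisos₁₂ F N), θ.Admissible F N ∧ D = datumOfRecord₁₂ F N θ hP ∧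
      ∃ binf : ℝ, Tendsto (beta0OfRecord₁₁ F N (θ.toStage11 F N p)) atTop (𝓝 binf) ∧
        ∀ k, |beta0OfRecord₁₁ F N (θ.toStage11 F N p) k - binf| ≤ c / (1 - ρ) * ρ ^ k := by
  obtain ⟨θ, hP, hθ, hD, -, ⟨hγ0, hγle⟩, -, -⟩ := h
  obtain ⟨hlim, hcoh, hadm⟩ := hin θ hP p hθ hD hγle
  refine ⟨θ, hP, hθ, hD, ?_⟩
  subst hD
  exact tendsto_beta0OfRecord₁₁_view_of_N17₁₂ θ hP p hγle hγ0 hρ0 hρ1 hlim hcoh hadm hN17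

end Summit.QuantumFields.YangMills.Theorems.BalabanUVNodesN17

end
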